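import Summits.QuantumFields.YangMills.Theorems.WeakCouplingRatesColdBoxOneScaleDatumDefs
import Summits.QuantumFields.YangMills.Theorems.WeakCouplingRatesColdBoxLargeFieldSU2
import HarnessLib

/-!
# Crux `UVSeamRec` (stmt-QuantumFields-20043), line «coldwall_pure»: large fields are rare in EVERY cold-wall box of the polynomial window,
# and the flat datum in the one-scale vocabulary of the route `WeakCouplingRates` (prelude of `…ColdWallKernelMeanPolyWindow`)

Helper file (`--supports stmt-QuantumFields-20043`) of the LEAD seat `ym-spine-20043-p1` (gen 14).  The route `WeakCouplingRates` (crux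
`BulkDominatesColdBoxW`, fleet `ym-wcr-*`) proved the ONE-SCALE EXPANSION of the box kernel mean for crude-good data at the single box size
`H = ⌈β^θ⌉` (`stub_kernelMeanExpansion`); its deterministic core `abs_kernelMean_sub_le_of_trunk` is stated for every `H`.  To instantiate it at the
COLD WALL for all `H ≤ ⌈β^θ⌉` at once (sequel) one needs the two inputs of this file:
* `boxState_real_largeField_le_of_le_ceil` — for `0 < θ`, `2θ < ε`: eventually in `β`, for EVERY `H ≤ ⌈β^θ⌉`, the `SU(2)` cold-wall box state gives
  «some plaquette touching `boxEdges 4 (2H+1)` costs `≥ β^{2ε−1}`» probability `≤ e^{−β^ε}` (the route's `boxState_largeField_rarity` is `H = ⌈β^θ⌉`;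
  same proof — Gibbs bound `exists_boxState_largeField_le` + `eventually_neg_rpow_add_le` — with the monotone cardinalities `#Λ ≤ 4(2H+1)⁴ ≤ 2500β^{4θ}`,
  `#Λ' ≤ 120(2H+1)⁴`);
* `one_eq_gnomonicChart_zero` — the flat datum `𝟙` is the chart point of `ϑ = 0` off the box (`gnomonicChart_zero`); its background circulation
  `sCirc (glue 0 (mean 0))` vanishes identically by the tree's `ColdBoxAllGroups.sCirc_glue_zero_mean_zero`.
HONEST FRAMING: bookkeeping on the route's theorems; nothing of E0′, NT or the gap; YM mass gap NOT proved; not Clay.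
-/

set_option autoImplicit false

noncomputable section

open MeasureTheory Finset Filter
open Literature.Probability.LatticeModels (Site)
open Literature.MathematicalPhysics.QuantumLattice
open Literature.MathematicalPhysics.QuantumFieldTheory
open Literature.MathematicalPhysics.QuantumFieldTheory.LatticeMaxwell
open Literature.MathematicalPhysics.QuantumFieldTheory.AxialGauge
open Summit.QuantumFields.YangMills.Theorems.WeakCouplingRates

namespace Summit.QuantumFields.YangMills.Cruxes.UVSeamRec.ClassicalResponse.ColdWall

/-- **Large fields in the cold-wall box, uniformly on the polynomial window.**  For `0 < θ`, `2θ < ε`: eventually in `β`, for EVERY half-side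
`H ≤ ⌈β^θ⌉`, the `SU(2)` cold-wall box state gives the event «some plaquette touching the box costs `≥ β^{2ε−1}`» probability `≤ e^{−β^ε}`
(the route's `boxState_largeField_rarity` is the case `H = ⌈β^θ⌉`; the cardinalities `#Λ ≤ 4(2H+1)⁴`, `#Λ' ≤ 120(2H+1)⁴` are monotone). [folklore] -/
theorem boxState_real_largeField_le_of_le_ceil {θ ε : ℝ} (hθ : 0 < θ) (hε : 2 * θ < ε) :
    ∃ β₀ : ℝ, ∀ β : ℝ, β₀ ≤ β → ∀ H : ℕ, H ≤ ⌈β ^ θ⌉₊ →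
      (boxState (fundamentalRep (Fin 2)) β H).real
          {U | ∃ p ∈ plaquettesTouching (AxialGauge.boxEdges 4 (2 * H + 1)),
            β ^ (2 * ε - 1) ≤ (2 : ℝ) - plaquetteObs (fundamentalRep (Fin 2)) p.1 p.2.1.1 p.2.1.2 U} ≤
        Real.exp (-(β ^ ε)) := by
  obtain ⟨c, hc, hmain⟩ := exists_boxState_largeField_le
  obtain ⟨β₀, hβ₀1, hasy⟩ := eventually_neg_rpow_add_le hθ hε (16 * 75000 + 2500 * |Real.log c|) (2500 * (3 / 2))
    (by positivity) (by positivity)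
  refine ⟨β₀, fun β hβ H hH => ?_⟩
  have hβ1 : 1 ≤ β := hβ₀1.trans hβ
  have hβ0 : 0 < β := one_pos.trans_le hβ1
  refine (hmain H β hβ1 (β ^ (2 * ε - 1))).trans ?_
  set n : ℕ := 2 * H + 1 with hn
  set Λ := AxialGauge.boxEdges 4 n with hΛ
  have hX1 : 1 ≤ β ^ θ := Real.one_le_rpow hβ1 hθ.le
  have hHr : (H : ℝ) ≤ (⌈β ^ θ⌉₊ : ℝ) := by exact_mod_cast hH
  have hnR : (n : ℝ) ≤ 5 * β ^ θ := by
    have hc' : (⌈β ^ θ⌉₊ : ℝ) < β ^ θ + 1 := Nat.ceil_lt_add_one (by linarith)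
    rw [hn]; push_cast; nlinarith
  have hn4 : (n : ℝ) ^ 4 ≤ 625 * β ^ (4 * θ) := by
    have e4 : β ^ (4 * θ) = (β ^ θ) ^ 4 := by
      rw [← Real.rpow_natCast (β ^ θ) 4, ← Real.rpow_mul hβ0.le]; norm_num; ring_nf
    rw [e4]
    calc (n : ℝ) ^ 4 ≤ (5 * β ^ θ) ^ 4 := pow_le_pow_left₀ (by positivity) hnR 4
      _ = 625 * (β ^ θ) ^ 4 := by ring
  have hΛR : (#Λ : ℝ) ≤ 2500 * β ^ (4 * θ) := by
    have h := card_boxEdges_four_le n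
    calc (#Λ : ℝ) ≤ ((4 * n ^ 4 : ℕ) : ℝ) := by rw [hΛ]; exact_mod_cast h
      _ = 4 * (n : ℝ) ^ 4 := by push_cast; ring
      _ ≤ 4 * (625 * β ^ (4 * θ)) := by linarith
      _ = 2500 * β ^ (4 * θ) := by ring
  have hΛ'R : (#(plaquettesTouching Λ) : ℝ) ≤ 75000 * β ^ (4 * θ) := by
    have h := card_plaquettesTouching_boxEdges_le n
    calc (#(plaquettesTouching Λ) : ℝ) ≤ ((120 * n ^ 4 : ℕ) : ℝ) := by rw [hΛ]; exact_mod_cast h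
      _ = 120 * (n : ℝ) ^ 4 := by push_cast; ring
      _ ≤ 120 * (625 * β ^ (4 * θ)) := by linarith
      _ = 75000 * β ^ (4 * θ) := by ring
  set a : ℝ := c * Real.sqrt β ^ 3 with ha
  have ha0 : 0 < a := by positivity
  have hloga : Real.log a ≤ |Real.log c| + 3 / 2 * Real.log β := by
    rw [ha, Real.log_mul hc.ne' (by positivity), Real.log_pow, Real.log_sqrt hβ0.le]
    have := le_abs_self (Real.log c)
    push_cast; linarith
  have hpow : a ^ #Λ = Real.exp (#Λ * Real.log a) := by
    rw [Real.exp_nat_mul, Real.exp_log ha0]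
  have hs : β * β ^ (2 * ε - 1) = β ^ (2 * ε) := by
    rw [show β * β ^ (2 * ε - 1) = β ^ (1 : ℝ) * β ^ (2 * ε - 1) by rw [Real.rpow_one], ← Real.rpow_add hβ0]; congr 1; ring
  rw [hpow, ← Real.exp_add, ← Real.exp_add, hs]
  refine Real.exp_le_exp.2 ?_
  have hlog0 : 0 ≤ Real.log β := Real.log_nonneg hβ1
  have hY0 : 0 ≤ β ^ (4 * θ) := Real.rpow_nonneg hβ0.le _
  have h3 : (#Λ : ℝ) * Real.log a ≤ 2500 * β ^ (4 * θ) * (|Real.log c| + 3 / 2 * Real.log β) := by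
    calc (#Λ : ℝ) * Real.log a ≤ #Λ * (|Real.log c| + 3 / 2 * Real.log β) :=
          mul_le_mul_of_nonneg_left hloga (Nat.cast_nonneg _)
      _ ≤ 2500 * β ^ (4 * θ) * (|Real.log c| + 3 / 2 * Real.log β) :=
          mul_le_mul_of_nonneg_right hΛR (by positivity)
  have h4 := hasy β hβ
  nlinarith [h3, h4, hΛ'R, abs_nonneg (Real.log c)]

/-- The flat datum in chart form: every link off the box is the chart point of `0`. [folklore] -/
theorem one_eq_gnomonicChart_zero (H : ℕ) :
    ∀ e : Literature.MathematicalPhysics.QuantumLattice.ZdEdge 4, e ∉ boxEdges 4 (2 * H + 1) →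
      (fun _ : Literature.MathematicalPhysics.QuantumLattice.ZdEdge 4 => (1 : Matrix.specialUnitaryGroup (Fin 2) ℂ)) e =
        gnomonicChart (fun c : Fin 3 => (0 : Fin 3 → Literature.MathematicalPhysics.QuantumLattice.ZdEdge 4 → ℝ) c e) := by
  intro e _
  have : (fun c : Fin 3 => (0 : Fin 3 → Literature.MathematicalPhysics.QuantumLattice.ZdEdge 4 → ℝ) c e) = 0 := by funext c; rfl
  rw [this, gnomonicChart_zero]

end Summit.QuantumFields.YangMills.Cruxes.UVSeamRec.ClassicalResponse.ColdWall

end
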